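import Summits.Ventures.PercRepro.Night2FatZDegen

/-!
# night-2: the pencil of class lines, and the side line — the geometry behind the free points

`H₀ = V = (G ∖ K) ∖ {w₀, x}` lies in `clF B₀`, which misses `w₀` and `x`.  A CLASS LINE is a rank-2 set `R ⊆ V` with
`rk (R ∪ {w₀, x}) ≤ 3`.
* **`rkN_union_le_three_of_class`** (the pencil): two class lines are coplanar — `rk (R ∪ R′) ≤ 3`;
* **`pencil_point_of_class_lines`**: two class lines spanning a plane and sharing a point `p` force `p ∈ clF {w₀, x}`
  (a PENCIL POINT); **`mem_clF_of_class_of_pencil`**: a pencil point lies on every class line;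
  **`pencil_point_unique`**: there is at most one pencil point in `V`.
* The side line (`M = π₃ ∖ L` collinear): **`mem_clF_side_of_coplanar_of_spine_of_off`** — a basis line `{a, c}` with
  `a` on the spine and `c` off it in `π₂` is coplanar with `M` only if `a ∈ clF M`; **`eq_of_mem_clF_pair_of_side`** — a
  line through a side point `d` and a point `b` carries no further point of `V` off `clF M` (the point is `b`);
  **`notMem_clF_side_of_plane_two`** — the points of `π₂` off the spine are off `clF M`;
  **`eq_of_mem_spine_of_mem_clF_side`** — at most one point of the spine lies in `clF M`.
Paper `proofs/NIGHT-2-g35.md` §4.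
-/

namespace PercRepro.Shadow

open PercRepro.ThmH PercRepro.PerFlat

variable {α : Type*} [DecidableEq α] {M : Matroid α} [M.Finite] {G : Finset α}

/-- A point whose insertion does not raise the rank lies in the closure. -/
theorem mem_clF_of_rkN_insert_le {S : Finset α} {p : α} (hp : p ∈ gr M) (h : rkN M (insert p S) ≤ rkN M S) :
    p ∈ clF M S := by
  by_contra hpS
  have := rkN_insert_of_notMem_clF hp hpS
  omega

/-- **The pencil**: two class lines `R, R′ ⊆ V` (with `w₀ ∉ clF V`) are coplanar. -/
theorem rkN_union_le_three_of_class (hs : ∀ e ∈ gr M, ∀ f ∈ gr M, e ≠ f → rkN M {e, f} = 2)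
    {V : Finset α} {w₀ x : α} (hw₀g : w₀ ∈ gr M) (hxg : x ∈ gr M) (hne : w₀ ≠ x)
    (hw₀V : w₀ ∉ clF M V) {R R' : Finset α} (hR : R ⊆ V) (hR' : R' ⊆ V)
    (hRc : rkN M (insert w₀ (insert x R)) ≤ 3) (hR'c : rkN M (insert w₀ (insert x R')) ≤ 3) :
    rkN M (R ∪ R') ≤ 3 := by
  have hsub := rkN_submod (M := M) (insert w₀ (insert x R)) (insert w₀ (insert x R'))
  have h2 : rkN M ({w₀, x} : Finset α) = 2 := hs w₀ hw₀g x hxg hne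
  have hinter : ({w₀, x} : Finset α) ⊆ insert w₀ (insert x R) ∩ insert w₀ (insert x R') := by
    intro e he
    rw [Finset.mem_insert, Finset.mem_singleton] at he
    rw [Finset.mem_inter, Finset.mem_insert, Finset.mem_insert, Finset.mem_insert, Finset.mem_insert]
    rcases he with rfl | rfl
    · exact ⟨Or.inl rfl, Or.inl rfl⟩
    · exact ⟨Or.inr (Or.inl rfl), Or.inr (Or.inl rfl)⟩
  have hi := rkN_mono (M := M) hinter
  have hun : insert w₀ (R ∪ R') ⊆ insert w₀ (insert x R) ∪ insert w₀ (insert x R') := by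
    intro e he
    rw [Finset.mem_insert, Finset.mem_union] at he
    rw [Finset.mem_union, Finset.mem_insert, Finset.mem_insert, Finset.mem_insert, Finset.mem_insert]
    rcases he with rfl | he | he
    · exact Or.inl (Or.inl rfl)
    · exact Or.inl (Or.inr (Or.inr he))
    · exact Or.inr (Or.inr (Or.inr he))
  have hu := rkN_mono (M := M) hun
  have hw₀RR : w₀ ∉ clF M (R ∪ R') := fun h =>
    hw₀V (clF_mono (Finset.union_subset hR hR') h)
  have := rkN_insert_of_notMem_clF hw₀g hw₀RR
  omega

/-- **A pencil point**: two class lines through `p` spanning a plane force `p ∈ clF {w₀, x}`. -/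
theorem pencil_point_of_class_lines (hs : ∀ e ∈ gr M, ∀ f ∈ gr M, e ≠ f → rkN M {e, f} = 2)
    {V : Finset α} (hVg : V ⊆ gr M) {w₀ x : α} (hw₀g : w₀ ∈ gr M) (hxg : x ∈ gr M) (hne : w₀ ≠ x)
    (hw₀V : w₀ ∉ clF M V) {R R' : Finset α} (hR : R ⊆ V) (hR' : R' ⊆ V) (hR2 : rkN M R = 2) (hR'2 : rkN M R' = 2)
    (hRc : rkN M (insert w₀ (insert x R)) ≤ 3) (hR'c : rkN M (insert w₀ (insert x R')) ≤ 3)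
    (hRR' : 3 ≤ rkN M (R ∪ R')) {p : α} (hpR : p ∈ R) (hpR' : p ∈ R') :
    p ∈ clF M ({w₀, x} : Finset α) := by
  have hRg : R ⊆ gr M := hR.trans hVg
  have hR'g : R' ⊆ gr M := hR'.trans hVg
  have hpg : p ∈ gr M := hRg hpR
  have hw₀R : w₀ ∉ clF M R := fun h => hw₀V (clF_mono hR h)
  have hw₀R' : w₀ ∉ clF M R' := fun h => hw₀V (clF_mono hR' h)
  have hr1 : rkN M (insert w₀ R) = 3 := by rw [rkN_insert_of_notMem_clF hw₀g hw₀R, hR2]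
  have hr1' : rkN M (insert w₀ R') = 3 := by rw [rkN_insert_of_notMem_clF hw₀g hw₀R', hR'2]
  -- `x ∈ clF (insert w₀ R)` and `x ∈ clF (insert w₀ R')`
  have hx1 : x ∈ clF M (insert w₀ R) := by
    apply mem_clF_of_rkN_insert_le hxg
    have : insert x (insert w₀ R) = insert w₀ (insert x R) := Finset.insert_comm _ _ _
    rw [this, hr1]
    exact hRc
  have hx1' : x ∈ clF M (insert w₀ R') := by
    apply mem_clF_of_rkN_insert_le hxg
    have : insert x (insert w₀ R') = insert w₀ (insert x R') := Finset.insert_comm _ _ _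
    rw [this, hr1']
    exact hR'c
  -- the two planes `clF (insert w₀ R)`, `clF (insert w₀ R')` meet in the line `clF {p, w₀}`
  have hXg : insert w₀ R ⊆ gr M := Finset.insert_subset hw₀g hRg
  have hYg : insert w₀ R' ⊆ gr M := Finset.insert_subset hw₀g hR'g
  have hmod := rkN_inter_clF_add_le hXg hYg
  have hw₀RR : w₀ ∉ clF M (R ∪ R') := fun h => hw₀V (clF_mono (Finset.union_subset hR hR') h)
  have hunion : insert w₀ R ∪ insert w₀ R' = insert w₀ (R ∪ R') := by
    ext e
    simp only [Finset.mem_union, Finset.mem_insert]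
    tauto
  have hrU : 4 ≤ rkN M (insert w₀ R ∪ insert w₀ R') := by
    rw [hunion, rkN_insert_of_notMem_clF hw₀g hw₀RR]
    omega
  have hI2 : rkN M (clF M (insert w₀ R) ∩ clF M (insert w₀ R')) ≤ 2 := by omega
  have hpw₀ : ({p, w₀} : Finset α) ⊆ clF M (insert w₀ R) ∩ clF M (insert w₀ R') := by
    intro e he
    rw [Finset.mem_insert, Finset.mem_singleton] at he
    rw [Finset.mem_inter]
    rcases he with rfl | rfl
    · exact ⟨subset_clF_of_subset_gr hXg (Finset.mem_insert_of_mem hpR),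
        subset_clF_of_subset_gr hYg (Finset.mem_insert_of_mem hpR')⟩
    · exact ⟨subset_clF_of_subset_gr hXg (Finset.mem_insert_self _ _),
        subset_clF_of_subset_gr hYg (Finset.mem_insert_self _ _)⟩
  have hpw₀2 : rkN M ({p, w₀} : Finset α) = 2 := by
    apply hs p hpg w₀ hw₀g
    rintro rfl
    exact hw₀V (subset_clF_of_subset_gr hVg (hR hpR))
  have hIg : clF M (insert w₀ R) ∩ clF M (insert w₀ R') ⊆ gr M :=
    fun e he => mem_gr_of_mem_clF (Finset.mem_inter.1 he).1
  have hcl : clF M ({p, w₀} : Finset α) = clF M (clF M (insert w₀ R) ∩ clF M (insert w₀ R')) :=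
    clF_eq_clF_of_subset_clF_of_rkN_le hIg (hpw₀.trans (subset_clF_of_subset_gr hIg)) (by omega)
  have hxI : x ∈ clF M (clF M (insert w₀ R) ∩ clF M (insert w₀ R')) :=
    subset_clF_of_subset_gr hIg (Finset.mem_inter.2 ⟨hx1, hx1'⟩)
  rw [← hcl] at hxI
  -- `x ∈ clF {p, w₀}` gives `p ∈ clF {w₀, x}`
  have hpwg : ({p, w₀} : Finset α) ⊆ gr M := Finset.insert_subset hpg (Finset.singleton_subset_iff.2 hw₀g)
  have hwxg : ({w₀, x} : Finset α) ⊆ gr M := Finset.insert_subset hw₀g (Finset.singleton_subset_iff.2 hxg)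
  have hsub : ({w₀, x} : Finset α) ⊆ clF M ({p, w₀} : Finset α) := by
    intro e he
    rw [Finset.mem_insert, Finset.mem_singleton] at he
    rcases he with rfl | rfl
    · exact subset_clF_of_subset_gr hpwg (Finset.mem_insert_of_mem (Finset.mem_singleton_self _))
    · exact hxI
  have hcl2 : clF M ({w₀, x} : Finset α) = clF M ({p, w₀} : Finset α) :=
    clF_eq_clF_of_subset_clF_of_rkN_le hpwg hsub (by rw [hpw₀2, hs w₀ hw₀g x hxg hne])
  rw [hcl2]
  exact subset_clF_of_subset_gr hpwg (Finset.mem_insert_self _ _)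

/-- **A pencil point lies on every class line.** -/
theorem mem_clF_of_class_of_pencil {V : Finset α} (hVg : V ⊆ gr M) {w₀ x : α} (hw₀g : w₀ ∈ gr M) (hxg : x ∈ gr M)
    (hw₀V : w₀ ∉ clF M V) {p : α} (hpV : p ∈ V) (hp : p ∈ clF M ({w₀, x} : Finset α))
    {R : Finset α} (hR : R ⊆ V) (hR2 : rkN M R = 2) (hRc : rkN M (insert w₀ (insert x R)) ≤ 3) :
    p ∈ clF M R := by
  have hRg : R ⊆ gr M := hR.trans hVg
  have hw₀R : w₀ ∉ clF M R := fun h => hw₀V (clF_mono hR h)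
  have hr1 : rkN M (insert w₀ R) = 3 := by rw [rkN_insert_of_notMem_clF hw₀g hw₀R, hR2]
  have hx1 : x ∈ clF M (insert w₀ R) := by
    apply mem_clF_of_rkN_insert_le hxg
    have : insert x (insert w₀ R) = insert w₀ (insert x R) := Finset.insert_comm _ _ _
    rw [this, hr1]
    exact hRc
  have hXg : insert w₀ R ⊆ gr M := Finset.insert_subset hw₀g hRg
  -- `p ∈ clF (insert w₀ R)`: `{w₀, x} ⊆ clF (insert w₀ R)`
  have hwx : ({w₀, x} : Finset α) ⊆ clF M (insert w₀ R) := by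
    intro e he
    rw [Finset.mem_insert, Finset.mem_singleton] at he
    rcases he with rfl | rfl
    · exact subset_clF_of_subset_gr hXg (Finset.mem_insert_self _ _)
    · exact hx1
  have hpX : p ∈ clF M (insert w₀ R) := clF_subset_clF_of_subset_clF hwx hp
  -- the plane `clF (insert w₀ R)` meets `clF V` in a line containing `R`
  have hmod := rkN_inter_clF_add_le hXg hVg
  have hunion : insert w₀ R ∪ V = insert w₀ V := by
    ext e
    simp only [Finset.mem_union, Finset.mem_insert]
    constructor
    · rintro ((rfl | he) | he)
      · exact Or.inl rfl
      · exact Or.inr (hR he)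
      · exact Or.inr he
    · rintro (rfl | he)
      · exact Or.inl (Or.inl rfl)
      · exact Or.inr he
  rw [hunion, rkN_insert_of_notMem_clF hw₀g hw₀V, hr1] at hmod
  have hI2 : rkN M (clF M (insert w₀ R) ∩ clF M V) ≤ 2 := by omega
  have hIg : clF M (insert w₀ R) ∩ clF M V ⊆ gr M := fun e he => mem_gr_of_mem_clF (Finset.mem_inter.1 he).1
  have hRI : R ⊆ clF M (insert w₀ R) ∩ clF M V := by
    intro e he
    exact Finset.mem_inter.2 ⟨subset_clF_of_subset_gr hXg (Finset.mem_insert_of_mem he),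
      subset_clF_of_subset_gr hVg (hR he)⟩
  have hcl : clF M R = clF M (clF M (insert w₀ R) ∩ clF M V) :=
    clF_eq_clF_of_subset_clF_of_rkN_le hIg (hRI.trans (subset_clF_of_subset_gr hIg)) (by omega)
  rw [hcl]
  exact subset_clF_of_subset_gr hIg (Finset.mem_inter.2 ⟨hpX, subset_clF_of_subset_gr hVg hpV⟩)

/-- **At most one pencil point in `V`.** -/
theorem pencil_point_unique (hs : ∀ e ∈ gr M, ∀ f ∈ gr M, e ≠ f → rkN M {e, f} = 2)
    {V : Finset α} (hVg : V ⊆ gr M) {w₀ x : α} (hw₀g : w₀ ∈ gr M) (hxg : x ∈ gr M) (hne : w₀ ≠ x)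
    (hw₀V : w₀ ∉ clF M V) {p p' : α} (hpV : p ∈ V) (hp'V : p' ∈ V)
    (hp : p ∈ clF M ({w₀, x} : Finset α)) (hp' : p' ∈ clF M ({w₀, x} : Finset α)) : p = p' := by
  by_contra hpp'
  have hpg : p ∈ gr M := hVg hpV
  have hp'g : p' ∈ gr M := hVg hp'V
  have hwxg : ({w₀, x} : Finset α) ⊆ gr M := Finset.insert_subset hw₀g (Finset.singleton_subset_iff.2 hxg)
  have hsub : ({p, p'} : Finset α) ⊆ clF M ({w₀, x} : Finset α) := by
    intro e he
    rw [Finset.mem_insert, Finset.mem_singleton] at he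
    rcases he with rfl | rfl
    · exact hp
    · exact hp'
  have hcl : clF M ({p, p'} : Finset α) = clF M ({w₀, x} : Finset α) :=
    clF_eq_clF_of_subset_clF_of_rkN_le hwxg hsub (by rw [hs w₀ hw₀g x hxg hne, hs p hpg p' hp'g hpp'])
  have hw₀ : w₀ ∈ clF M ({p, p'} : Finset α) := by
    rw [hcl]
    exact subset_clF_of_subset_gr hwxg (Finset.mem_insert_self _ _)
  have hppV : ({p, p'} : Finset α) ⊆ V := Finset.insert_subset hpV (Finset.singleton_subset_iff.2 hp'V)
  exact hw₀V (clF_mono hppV hw₀)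

end PercRepro.Shadow
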